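import Summits.HubbardSuperconductivity.HubbardSuperconductivity.Theorems.KLProgrammeKLRegimeScaleZeroDiagConstFirstOrder
import Summits.HubbardSuperconductivity.HubbardSuperconductivity.Theorems.KLProgrammeKLRegimeFlowReadScaleZeroAssembly
import Summits.HubbardSuperconductivity.HubbardSuperconductivity.Theorems.KLProgrammeKLRegimeScaleZeroTadpoleBridge
import Summits.HubbardSuperconductivity.HubbardSuperconductivity.Theorems.KLProgrammeKLRegimeScaleZeroTadpoleRegime
import Summits.HubbardSuperconductivity.HubbardSuperconductivity.Theorems.KLProgrammeKLRegimeSplitFermiPointC4Regime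

/-!
# Route `KLProgramme`, crux K3 — ENGINE (stmt-HubbardSuperconductivity-20437), row (C) credit path, GAP **G-005** «(C)-TADPOLE-NONVANISHING»:
# OWNER LEMMA, PART 2 — `|ν₀(θ) + U·T₀| ≤ E` in the currency of `twoLegRead_frameZero_of_sunsetData`, its mean/oscillation form, and G-005 from it

Seat hubbard-kl-k3c5-p1 (g19; writer of the G-005 owner lemma, pen (R435)(B)/(R436)(B); p1b g18 x-reads).  «G005-SHORT-ROAD»: at ORDER ZERO
the split `W₀ = W_a″ + S + Q_c + D_e` of `…FlowReadScaleZeroAssembly.twoLegRead_frameZero_of_sunsetData` gives the STRUCTURED value of the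
scale-`0` read `ν₀(θ) = klLocalPart L M β U μ 0 0 θ` about the first-order Hartree constant `−U·T₀`, `T₀ := Re Σ_k (βL²)⁻²Ψ⁰(k,0)` (REAL and
`= L⁻²·`UV Hartree sum, `…ScaleZeroTadpoleBridge`; `≥ 1/128` on the engine regime, `…ScaleZeroTadpoleRegime`); `ε = β/4M`;
`E := 2·tv·|U| + (2·tb0 + bSA + a 0 + 2048 + 64ε)·U²`.  Hypotheses = a SUBSET of the consumer's, verbatim (the off-site tail row at `k = 0` only): `hTon`/`hToff0`, plain
sunset sum `hSall`, free curve `hγ`/`hD`, chain aliasing table `hA`.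
* §2 **`scaleZeroRead_add_firstOrder_le`** — `∀ θ, |ν₀(θ) + U·T₀| ≤ E` (`W_a″` by `gridSymbol_norm_le_of_pinned` from its pinned rows; `|H_S| ≤ bSA·U²`
  `sunset_value_le`; `|H_{Q_c}(γ₀θ)| ≤ a₀U²` `chain_readJets_frameZero_le_bell4`; `H_{D_e} ≡ c_e` `scaleZeroDiag_symbol_const`; `|c_e + U·T₀| ≤ (2048+64ε)U²`
  part 1); `contDiff_four_klLocalPart_frameZero` (`ν₀ ∈ C⁴` from `hγ`);
* §2c regime suppliers for the discharge: `freeFermiPointLp_C4` (free curve `C⁴` + derivative table, from `fermiPointLp_C4_of_frameOK` at the bare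
  frame) and `scaleZero_tadpole_re_ge_inv_128` (`T₀ ≥ 1/128`, `…TadpoleRegime` ∘ `…TadpoleBridge`).
G-005 itself (mean/oscillation, route (B) ✓ p718566, and the DISCHARGE of the rows on the engine regime) is the next file `…ScaleZeroTadpoleNonvanishing`.
Proofs only; no definitions; the rows are HYPOTHESES; nothing here asserts (C), any stub of 20437, K3 or superconductivity; G-005 holds MODULO
the same producer rows as the (C) `n = 0` closer plus `hfit`.  References: BGM 2006 §2.1 (2.3)–(2.6), §2.3–§2.4, §3 (3.2) [cite: BenfattoGiulianiMastropietro2006].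
-/

noncomputable section

namespace Summit.HubbardSuperconductivity.HubbardSuperconductivity.Theorems.KLRegimeSplit

set_option linter.dupNamespace false -- summit = problem name (single-conjunct summit), D-0017

open Real Finset Complex Literature.MathematicalPhysics.QuantumLattice Literature.Probability.LatticeModels GrassmannAlgebra Matrix
open Literature.MathematicalPhysics.QuantumLattice.FermiRG Literature.Probability.LatticeModels.BattleFederbush
open Summit.HubbardSuperconductivity.HubbardSuperconductivity.Theorems.KLProgrammeLegKernels
open Summit.HubbardSuperconductivity.HubbardSuperconductivity.Theorems.TwoLegFourier
open Summit.HubbardSuperconductivity.HubbardSuperconductivity.Theorems.EngineV8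
open Summit.HubbardSuperconductivity.HubbardSuperconductivity.Theorems.PerturbedFermiCurve
open Summit.HubbardSuperconductivity.HubbardSuperconductivity.Theorems.DispersionFlow
open Summit.HubbardSuperconductivity.HubbardSuperconductivity.Theorems.C4a (bell4)
open scoped Nat

/-! ## §2a The off-site row of `W_a″` at `k = 0` -/

section RowZero

variable {L M : ℕ} [NeZero L] [NeZero M] {μ U β : ℝ}

/-- **Row `(a-off)` of `W_a″ = W₀ − S − Q_c − D_e` at `k = 0`** from the off-site tail row at `k = 0` alone (`…AssemblyRows.scaleZeroWa_offSite_row`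
takes all `k ≤ 4`; G-005 needs only the unweighted one). [cite: BenfattoGiulianiMastropietro2006, §2.2 (2.13)-(2.14)] -/
theorem scaleZeroWa_offSite_row_zero {tb0 : ℝ}
    (hToff0 : ∀ (σ : Fin 2) (p₀ : GridPoint L (2 * (2 * M))), ∑ p₁ : GridPoint L (2 * (2 * M)),
      (if p₁.2 - p₀.2 = 0 then (0 : ℝ) else
        (1 + (((p₁.2 - p₀.2) 0).valMinAbs.natAbs : ℝ) + (((p₁.2 - p₀.2) 1).valMinAbs.natAbs : ℝ)) ^ 0) *
        ‖kernel ℂ (effAction ℂ ((hubbardGridSub L M β (2 * (2 * M))).transpose * hubbardCovAboveCT L M β μ 0 0 klE0 *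
            hubbardGridSub L M β (2 * (2 * M))) (hubbardGridInteraction L (2 * (2 * M)) β U) -
          gaussConv ℂ ((hubbardGridSub L M β (2 * (2 * M))).transpose * hubbardCovAboveCT L M β μ 0 0 klE0 *
            hubbardGridSub L M β (2 * (2 * M))) (hubbardGridInteraction L (2 * (2 * M)) β U) +
        (2 : ℂ)⁻¹ • (gaussConv ℂ ((hubbardGridSub L M β (2 * (2 * M))).transpose * hubbardCovAboveCT L M β μ 0 0 klE0 *
              hubbardGridSub L M β (2 * (2 * M))) (hubbardGridInteraction L (2 * (2 * M)) β U * hubbardGridInteraction L (2 * (2 * M)) β U) -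
          gaussConv ℂ ((hubbardGridSub L M β (2 * (2 * M))).transpose * hubbardCovAboveCT L M β μ 0 0 klE0 *
              hubbardGridSub L M β (2 * (2 * M))) (hubbardGridInteraction L (2 * (2 * M)) β U) *
            gaussConv ℂ ((hubbardGridSub L M β (2 * (2 * M))).transpose * hubbardCovAboveCT L M β μ 0 0 klE0 *
              hubbardGridSub L M β (2 * (2 * M))) (hubbardGridInteraction L (2 * (2 * M)) β U))) 2 (fun i => ((![p₀, p₁] i, σ), i))‖ ≤ tb0 * U ^ 2 * (β / ((2 * (2 * M) : ℕ) : ℝ)))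
    (σ : Fin 2) (p₀ : GridPoint L (2 * (2 * M))) :
    ∑ p₁ : GridPoint L (2 * (2 * M)), (if p₁.2 - p₀.2 = 0 then (0 : ℝ) else
        (1 + (((p₁.2 - p₀.2) 0).valMinAbs.natAbs : ℝ) + (((p₁.2 - p₀.2) 1).valMinAbs.natAbs : ℝ)) ^ 0) *
      ‖kernel ℂ (effAction ℂ ((hubbardGridSub L M β (2 * (2 * M))).transpose * hubbardCovAboveCT L M β μ 0 0 klE0 *
          hubbardGridSub L M β (2 * (2 * M))) (hubbardGridInteraction L (2 * (2 * M)) β U) -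
        (∑ p' : GridPoint L (2 * (2 * M)), ∑ q' : GridPoint L (2 * (2 * M)), ∑ σ' : Fin 2,
          (if p' = q' then (0 : ℂ) else
            -((((U * (β / (2 * (2 * M) : ℕ)) : ℝ) : ℂ) ^ 2 *
              (contr ℂ ((hubbardGridSub L M β (2 * (2 * M))).transpose * hubbardCovAboveCT L M β μ 0 0 klE0 *
                  hubbardGridSub L M β (2 * (2 * M))) (((q', σ'), 0) : GridLeg (GridPoint L (2 * (2 * M)))) ((p', σ'), 1) *
                (contr ℂ ((hubbardGridSub L M β (2 * (2 * M))).transpose * hubbardCovAboveCT L M β μ 0 0 klE0 *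
                    hubbardGridSub L M β (2 * (2 * M))) (((p', σ'.rev), 0) : GridLeg (GridPoint L (2 * (2 * M)))) ((q', σ'.rev), 1) *
                  contr ℂ ((hubbardGridSub L M β (2 * (2 * M))).transpose * hubbardCovAboveCT L M β μ 0 0 klE0 *
                    hubbardGridSub L M β (2 * (2 * M))) (((q', σ'.rev), 0) : GridLeg (GridPoint L (2 * (2 * M)))) ((p', σ'.rev), 1)))))) •
            (gen ℂ (((p', σ'), 0) : GridLeg (GridPoint L (2 * (2 * M)))) * gen ℂ (((q', σ'), 1) : GridLeg (GridPoint L (2 * (2 * M)))))) -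
        (∑ p' : GridPoint L (2 * (2 * M)), ∑ q' : GridPoint L (2 * (2 * M)), ∑ σ' : Fin 2,
          ((((U * (β / (2 * (2 * M) : ℕ)) : ℝ) : ℂ) ^ 2 *
              ((-∑ k : FreqMomentum L M, ((1 / (β * (L : ℝ) ^ 2) : ℝ) : ℂ) ^ 2 * uvSymbolCT L M β μ 0 klE0 (k, 0)) *
               (-∑ k : FreqMomentum L M, ((1 / (β * (L : ℝ) ^ 2) : ℝ) : ℂ) ^ 2 * uvSymbolCT L M β μ 0 klE0 (k, 0)))) *
            contr ℂ ((hubbardGridSub L M β (2 * (2 * M))).transpose * hubbardCovAboveCT L M β μ 0 0 klE0 *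
              hubbardGridSub L M β (2 * (2 * M))) (((q', σ'), 0) : GridLeg (GridPoint L (2 * (2 * M)))) ((p', σ'), 1)) •
            (gen ℂ (((p', σ'), 0) : GridLeg (GridPoint L (2 * (2 * M)))) * gen ℂ (((q', σ'), 1) : GridLeg (GridPoint L (2 * (2 * M)))))) -
        (∑ p' : GridPoint L (2 * (2 * M)), ∑ σ' : Fin 2,
          ((2 : ℂ) * ((2 : ℂ)⁻¹ * (((U * (β / (2 * (2 * M) : ℕ)) : ℝ) : ℂ) *
              (-∑ k : FreqMomentum L M, ((1 / (β * (L : ℝ) ^ 2) : ℝ) : ℂ) ^ 2 * uvSymbolCT L M β μ 0 klE0 (k, 0))) +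
            (2 : ℂ)⁻¹ * (((U * (β / (2 * (2 * M) : ℕ)) : ℝ) : ℂ) ^ 2 *
              ((-∑ k : FreqMomentum L M, ((1 / (β * (L : ℝ) ^ 2) : ℝ) : ℂ) ^ 2 * uvSymbolCT L M β μ 0 klE0 (k, 0)) *
                ∑ q : GridPoint L (2 * (2 * M)),
                  contr ℂ ((hubbardGridSub L M β (2 * (2 * M))).transpose * hubbardCovAboveCT L M β μ 0 0 klE0 *
                      hubbardGridSub L M β (2 * (2 * M))) (((p', σ'.rev), 0) : GridLeg (GridPoint L (2 * (2 * M)))) ((q, σ'.rev), 1) *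
                    contr ℂ ((hubbardGridSub L M β (2 * (2 * M))).transpose * hubbardCovAboveCT L M β μ 0 0 klE0 *
                      hubbardGridSub L M β (2 * (2 * M))) (((q, σ'.rev), 0) : GridLeg (GridPoint L (2 * (2 * M)))) ((p', σ'.rev), 1))) -
            (2 : ℂ)⁻¹ * ((((U * (β / (2 * (2 * M) : ℕ)) : ℝ) : ℂ) ^ 2 *
                ((-∑ k : FreqMomentum L M, ((1 / (β * (L : ℝ) ^ 2) : ℝ) : ℂ) ^ 2 * uvSymbolCT L M β μ 0 klE0 (k, 0)) *
                 (-∑ k : FreqMomentum L M, ((1 / (β * (L : ℝ) ^ 2) : ℝ) : ℂ) ^ 2 * uvSymbolCT L M β μ 0 klE0 (k, 0)))) *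
              (-∑ k : FreqMomentum L M, ((1 / (β * (L : ℝ) ^ 2) : ℝ) : ℂ) ^ 2 * uvSymbolCT L M β μ 0 klE0 (k, 0))))) •
            (gen ℂ (((p', σ'), 0) : GridLeg (GridPoint L (2 * (2 * M)))) * gen ℂ (((p', σ'), 1) : GridLeg (GridPoint L (2 * (2 * M))))))) 2 (fun i => ((![p₀, p₁] i, σ), i))‖ ≤ tb0 * U ^ 2 * (β / ((2 * (2 * M) : ℕ) : ℝ)) := by
  have h := sum_weight_norm_kernel_two_scaleZero_sub_sunset_chain_diag_eq (L := L) (M := M) β U μ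
    (fun p₀ p₁ : GridPoint L (2 * (2 * M)) => if p₁.2 - p₀.2 = 0 then (0 : ℝ) else
      (1 + (((p₁.2 - p₀.2) 0).valMinAbs.natAbs : ℝ) + (((p₁.2 - p₀.2) 1).valMinAbs.natAbs : ℝ)) ^ 0) σ p₀
  beta_reduce at h
  rw [h]
  exact hToff0 σ p₀

end RowZero

/-! ## §2 The owner lemma: the scale-`0` read is `−U·T₀` up to `O(U²)` (consumer currency) -/

section Owner

variable {L M : ℕ} [NeZero L] [NeZero M] {μ U β : ℝ}

set_option maxHeartbeats 400000 in -- door-sized instantiations of written-out grid elements in one declaration (as in `…FlowReadScaleZeroAssembly`)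
/-- **THE OWNER LEMMA OF G-005** («ν₀(θ) = c_T·U + r(θ), |r| ≤ c₂U²» with `c_T·U = −U·T₀`): under the tail rows, the plain sunset sum, the free
curve and the chain's aliasing table of `twoLegRead_frameZero_of_sunsetData` (verbatim),
`|ν₀(θ) + U·T₀| ≤ 2·tv·|U| + (2·tb0 + bSA + a 0 + 2048 + 64ε)·U²` at every angle. [cite: BenfattoGiulianiMastropietro2006, §2.3-§2.4] -/
theorem scaleZeroRead_add_firstOrder_le (hβ : klBetaMin ≤ β) (hμ : μ ∈ klWindowC) {tv tb0 bSA : ℝ} {D a : ℕ → ℝ}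
    {Mdeg : ℕ} (hM : 8 ≤ Mdeg)
    (hTon : ∀ (σ : Fin 2) (p₀ : GridPoint L (2 * (2 * M))), ∑ p₁ : GridPoint L (2 * (2 * M)),
      (if p₁.2 - p₀.2 = 0 then (1 : ℝ) else 0) * ‖kernel ℂ (effAction ℂ ((hubbardGridSub L M β (2 * (2 * M))).transpose * hubbardCovAboveCT L M β μ 0 0 klE0 *
            hubbardGridSub L M β (2 * (2 * M))) (hubbardGridInteraction L (2 * (2 * M)) β U) -
          gaussConv ℂ ((hubbardGridSub L M β (2 * (2 * M))).transpose * hubbardCovAboveCT L M β μ 0 0 klE0 *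
            hubbardGridSub L M β (2 * (2 * M))) (hubbardGridInteraction L (2 * (2 * M)) β U) +
        (2 : ℂ)⁻¹ • (gaussConv ℂ ((hubbardGridSub L M β (2 * (2 * M))).transpose * hubbardCovAboveCT L M β μ 0 0 klE0 *
              hubbardGridSub L M β (2 * (2 * M))) (hubbardGridInteraction L (2 * (2 * M)) β U * hubbardGridInteraction L (2 * (2 * M)) β U) -
          gaussConv ℂ ((hubbardGridSub L M β (2 * (2 * M))).transpose * hubbardCovAboveCT L M β μ 0 0 klE0 *
              hubbardGridSub L M β (2 * (2 * M))) (hubbardGridInteraction L (2 * (2 * M)) β U) *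
            gaussConv ℂ ((hubbardGridSub L M β (2 * (2 * M))).transpose * hubbardCovAboveCT L M β μ 0 0 klE0 *
              hubbardGridSub L M β (2 * (2 * M))) (hubbardGridInteraction L (2 * (2 * M)) β U))) 2 (fun i => ((![p₀, p₁] i, σ), i))‖ ≤ tv * |U| * (β / ((2 * (2 * M) : ℕ) : ℝ)))
    (hToff0 : ∀ (σ : Fin 2) (p₀ : GridPoint L (2 * (2 * M))), ∑ p₁ : GridPoint L (2 * (2 * M)),
      (if p₁.2 - p₀.2 = 0 then (0 : ℝ) else
        (1 + (((p₁.2 - p₀.2) 0).valMinAbs.natAbs : ℝ) + (((p₁.2 - p₀.2) 1).valMinAbs.natAbs : ℝ)) ^ 0) *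
        ‖kernel ℂ (effAction ℂ ((hubbardGridSub L M β (2 * (2 * M))).transpose * hubbardCovAboveCT L M β μ 0 0 klE0 *
            hubbardGridSub L M β (2 * (2 * M))) (hubbardGridInteraction L (2 * (2 * M)) β U) -
          gaussConv ℂ ((hubbardGridSub L M β (2 * (2 * M))).transpose * hubbardCovAboveCT L M β μ 0 0 klE0 *
            hubbardGridSub L M β (2 * (2 * M))) (hubbardGridInteraction L (2 * (2 * M)) β U) +
        (2 : ℂ)⁻¹ • (gaussConv ℂ ((hubbardGridSub L M β (2 * (2 * M))).transpose * hubbardCovAboveCT L M β μ 0 0 klE0 *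
              hubbardGridSub L M β (2 * (2 * M))) (hubbardGridInteraction L (2 * (2 * M)) β U * hubbardGridInteraction L (2 * (2 * M)) β U) -
          gaussConv ℂ ((hubbardGridSub L M β (2 * (2 * M))).transpose * hubbardCovAboveCT L M β μ 0 0 klE0 *
              hubbardGridSub L M β (2 * (2 * M))) (hubbardGridInteraction L (2 * (2 * M)) β U) *
            gaussConv ℂ ((hubbardGridSub L M β (2 * (2 * M))).transpose * hubbardCovAboveCT L M β μ 0 0 klE0 *
              hubbardGridSub L M β (2 * (2 * M))) (hubbardGridInteraction L (2 * (2 * M)) β U))) 2 (fun i => ((![p₀, p₁] i, σ), i))‖ ≤ tb0 * U ^ 2 * (β / ((2 * (2 * M) : ℕ) : ℝ)))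
    (hSall : ∀ (σ : Fin 2) (p₀ : GridPoint L (2 * (2 * M))), ∑ p₁ : GridPoint L (2 * (2 * M)),
      (if p₁ = p₀ then (0 : ℝ) else (1 : ℝ) * ‖contr ℂ ((hubbardGridSub L M β (2 * (2 * M))).transpose * hubbardCovAboveCT L M β μ 0 0 klE0 *
                hubbardGridSub L M β (2 * (2 * M))) (((p₁, σ), 0) : GridLeg (GridPoint L (2 * (2 * M)))) ((p₀, σ), 1) *
              (contr ℂ ((hubbardGridSub L M β (2 * (2 * M))).transpose * hubbardCovAboveCT L M β μ 0 0 klE0 *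
                hubbardGridSub L M β (2 * (2 * M))) (((p₀, σ.rev), 0) : GridLeg (GridPoint L (2 * (2 * M)))) ((p₁, σ.rev), 1) *
                contr ℂ ((hubbardGridSub L M β (2 * (2 * M))).transpose * hubbardCovAboveCT L M β μ 0 0 klE0 *
                hubbardGridSub L M β (2 * (2 * M))) (((p₁, σ.rev), 0) : GridLeg (GridPoint L (2 * (2 * M)))) ((p₀, σ.rev), 1))‖) ≤ bSA * (((2 * (2 * M) : ℕ) : ℝ) / β))
    (hγ : ContDiff ℝ 4 fun θ : ℝ => (WithLp.toLp 2 (klFermiPoint μ 0 θ) : Momentum))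
    (hD : ∀ θ : ℝ, ∀ i, 1 ≤ i → i ≤ 4 → ‖iteratedDeriv i (fun θ : ℝ => (WithLp.toLp 2 (klFermiPoint μ 0 θ) : Momentum)) θ‖ ≤ D i)
    (hA : ∀ j ≤ 4, 2 * ((3 : ℝ) ^ j *
      (‖(-(((U * (β / (2 * (2 * M) : ℕ)) : ℝ) : ℂ) ^ 2 *
              ((-∑ k : FreqMomentum L M, ((1 / (β * (L : ℝ) ^ 2) : ℝ) : ℂ) ^ 2 * uvSymbolCT L M β μ 0 klE0 (k, 0)) *
               (-∑ k : FreqMomentum L M, ((1 / (β * (L : ℝ) ^ 2) : ℝ) : ℂ) ^ 2 * uvSymbolCT L M β μ 0 klE0 (k, 0)))) * ((((2 * (2 * M) : ℕ) : ℂ) ^ 2 / (β ^ 3 * (L : ℝ) ^ 2 : ℝ)) : ℂ))‖ *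
        (8 * (|β * (L : ℝ) ^ 2| * (2 / klE0)) * ((Mdeg ! : ℝ)) ^ 2 * (4 * 4 * (1 + 2 * (16 * (1 + 342) / klE0))) ^ Mdeg)) *
      (2 / ((2 * (L / 4 + 1) : ℕ) : ℝ)) ^ (Mdeg - j - 4) * (2 ^ 2 * ∑' k : Fin 2 → ℤ, ∏ i, (1 + (k i : ℝ) ^ 2)⁻¹)) ≤ a j * U ^ 2) (θ : ℝ) :
    |klLocalPart L M β U μ 0 0 θ + U * (∑ k : FreqMomentum L M, ((1 / (β * (L : ℝ) ^ 2) : ℝ) : ℂ) ^ 2 * uvSymbolCT L M β μ 0 klE0 (k, 0)).re| ≤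
      2 * tv * |U| + (2 * tb0 + bSA + a 0 + 2048 + 64 * (β / ((2 * (2 * M) : ℕ) : ℝ))) * U ^ 2 := by
  have hβ0 : 0 < β := lt_of_lt_of_le (by norm_num [klBetaMin]) hβ
  have hN : (0 : ℝ) < ((2 * (2 * M) : ℕ) : ℝ) := by have := NeZero.ne M; positivity
  -- the four pieces' own facts, BEFORE naming (so that `set` folds them)
  have hce := abs_diagConst_add_firstOrder_le (L := L) (M := M) hβ0 U μ
  have hDc := scaleZeroDiag_symbol_const (L := L) (M := M) (μ := μ) (U := U) (β := β)
  have hSv := sunset_value_le (L := L) (M := M) (μ := μ) (U := U) hβ0 hSall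
  have hQv : ∀ θ' : ℝ, |evalM (symInterp L (fun pp : TorusSite 2 L =>
        (∑ σσ : Fin 2, ((selfEnergy L M β ((ExteriorAlgebra.map (Matrix.toLin' (gridSubMatrix L M β
            (fun p : GridPoint L (2 * (2 * M)) => p.2) (fun p => gridTime β (2 * (2 * M)) p.1)))) ((∑ p' : GridPoint L (2 * (2 * M)), ∑ q' : GridPoint L (2 * (2 * M)), ∑ σ' : Fin 2,
          ((((U * (β / (2 * (2 * M) : ℕ)) : ℝ) : ℂ) ^ 2 *
              ((-∑ k : FreqMomentum L M, ((1 / (β * (L : ℝ) ^ 2) : ℝ) : ℂ) ^ 2 * uvSymbolCT L M β μ 0 klE0 (k, 0)) *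
               (-∑ k : FreqMomentum L M, ((1 / (β * (L : ℝ) ^ 2) : ℝ) : ℂ) ^ 2 * uvSymbolCT L M β μ 0 klE0 (k, 0)))) *
            contr ℂ ((hubbardGridSub L M β (2 * (2 * M))).transpose * hubbardCovAboveCT L M β μ 0 0 klE0 *
              hubbardGridSub L M β (2 * (2 * M))) (((q', σ'), 0) : GridLeg (GridPoint L (2 * (2 * M)))) ((p', σ'), 1)) •
            (gen ℂ (((p', σ'), 0) : GridLeg (GridPoint L (2 * (2 * M)))) * gen ℂ (((q', σ'), 1) : GridLeg (GridPoint L (2 * (2 * M)))))))) (omega0 M, pp) σσ).re +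
        (selfEnergy L M β ((ExteriorAlgebra.map (Matrix.toLin' (gridSubMatrix L M β
            (fun p : GridPoint L (2 * (2 * M)) => p.2) (fun p => gridTime β (2 * (2 * M)) p.1)))) ((∑ p' : GridPoint L (2 * (2 * M)), ∑ q' : GridPoint L (2 * (2 * M)), ∑ σ' : Fin 2,
          ((((U * (β / (2 * (2 * M) : ℕ)) : ℝ) : ℂ) ^ 2 *
              ((-∑ k : FreqMomentum L M, ((1 / (β * (L : ℝ) ^ 2) : ℝ) : ℂ) ^ 2 * uvSymbolCT L M β μ 0 klE0 (k, 0)) *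
               (-∑ k : FreqMomentum L M, ((1 / (β * (L : ℝ) ^ 2) : ℝ) : ℂ) ^ 2 * uvSymbolCT L M β μ 0 klE0 (k, 0)))) *
            contr ℂ ((hubbardGridSub L M β (2 * (2 * M))).transpose * hubbardCovAboveCT L M β μ 0 0 klE0 *
              hubbardGridSub L M β (2 * (2 * M))) (((q', σ'), 0) : GridLeg (GridPoint L (2 * (2 * M)))) ((p', σ'), 1)) •
            (gen ℂ (((p', σ'), 0) : GridLeg (GridPoint L (2 * (2 * M)))) * gen ℂ (((q', σ'), 1) : GridLeg (GridPoint L (2 * (2 * M)))))))) ((omega0 M).rev, pp) σσ).re)) / 4)) (WithLp.toLp 2 (klFermiPoint μ 0 θ') : Momentum)| ≤ a 0 * U ^ 2 := fun θ' =>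
    (chain_readJets_frameZero_le_bell4 (L := L) (M := M) hβ0 hμ (((U * (β / (2 * (2 * M) : ℕ)) : ℝ) : ℂ) ^ 2 *
              ((-∑ k : FreqMomentum L M, ((1 / (β * (L : ℝ) ^ 2) : ℝ) : ℂ) ^ 2 * uvSymbolCT L M β μ 0 klE0 (k, 0)) *
               (-∑ k : FreqMomentum L M, ((1 / (β * (L : ℝ) ^ 2) : ℝ) : ℂ) ^ 2 * uvSymbolCT L M β μ 0 klE0 (k, 0)))) hM hγ hD (A := fun j => a j * U ^ 2) hA θ').1
  have hBon := scaleZeroWa_onSite_row (L := L) (M := M) (μ := μ) (U := U) (β := β) hTon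
  have hBoff := scaleZeroWa_offSite_row_zero (L := L) (M := M) (μ := μ) (U := U) (β := β) hToff0
  -- names
  set xg : GridPoint L (2 * (2 * M)) → TorusSite 2 L := fun p => p.2 with hxg
  set τg : GridPoint L (2 * (2 * M)) → ℝ := fun p => gridTime β (2 * (2 * M)) p.1 with hτg
  set W0 : GrassmannAlgebra ℂ (GridLeg (GridPoint L (2 * (2 * M)))) := effAction ℂ ((hubbardGridSub L M β (2 * (2 * M))).transpose * hubbardCovAboveCT L M β μ 0 0 klE0 *
          hubbardGridSub L M β (2 * (2 * M))) (hubbardGridInteraction L (2 * (2 * M)) β U) with hW0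
  set WS : GrassmannAlgebra ℂ (GridLeg (GridPoint L (2 * (2 * M)))) := (∑ p' : GridPoint L (2 * (2 * M)), ∑ q' : GridPoint L (2 * (2 * M)), ∑ σ' : Fin 2,
          (if p' = q' then (0 : ℂ) else
            -((((U * (β / (2 * (2 * M) : ℕ)) : ℝ) : ℂ) ^ 2 *
              (contr ℂ ((hubbardGridSub L M β (2 * (2 * M))).transpose * hubbardCovAboveCT L M β μ 0 0 klE0 *
                  hubbardGridSub L M β (2 * (2 * M))) (((q', σ'), 0) : GridLeg (GridPoint L (2 * (2 * M)))) ((p', σ'), 1) *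
                (contr ℂ ((hubbardGridSub L M β (2 * (2 * M))).transpose * hubbardCovAboveCT L M β μ 0 0 klE0 *
                    hubbardGridSub L M β (2 * (2 * M))) (((p', σ'.rev), 0) : GridLeg (GridPoint L (2 * (2 * M)))) ((q', σ'.rev), 1) *
                  contr ℂ ((hubbardGridSub L M β (2 * (2 * M))).transpose * hubbardCovAboveCT L M β μ 0 0 klE0 *
                    hubbardGridSub L M β (2 * (2 * M))) (((q', σ'.rev), 0) : GridLeg (GridPoint L (2 * (2 * M)))) ((p', σ'.rev), 1)))))) •
            (gen ℂ (((p', σ'), 0) : GridLeg (GridPoint L (2 * (2 * M)))) * gen ℂ (((q', σ'), 1) : GridLeg (GridPoint L (2 * (2 * M)))))) with hWS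
  set WQ : GrassmannAlgebra ℂ (GridLeg (GridPoint L (2 * (2 * M)))) := (∑ p' : GridPoint L (2 * (2 * M)), ∑ q' : GridPoint L (2 * (2 * M)), ∑ σ' : Fin 2,
          ((((U * (β / (2 * (2 * M) : ℕ)) : ℝ) : ℂ) ^ 2 *
              ((-∑ k : FreqMomentum L M, ((1 / (β * (L : ℝ) ^ 2) : ℝ) : ℂ) ^ 2 * uvSymbolCT L M β μ 0 klE0 (k, 0)) *
               (-∑ k : FreqMomentum L M, ((1 / (β * (L : ℝ) ^ 2) : ℝ) : ℂ) ^ 2 * uvSymbolCT L M β μ 0 klE0 (k, 0)))) *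
            contr ℂ ((hubbardGridSub L M β (2 * (2 * M))).transpose * hubbardCovAboveCT L M β μ 0 0 klE0 *
              hubbardGridSub L M β (2 * (2 * M))) (((q', σ'), 0) : GridLeg (GridPoint L (2 * (2 * M)))) ((p', σ'), 1)) •
            (gen ℂ (((p', σ'), 0) : GridLeg (GridPoint L (2 * (2 * M)))) * gen ℂ (((q', σ'), 1) : GridLeg (GridPoint L (2 * (2 * M)))))) with hWQ
  set WD : GrassmannAlgebra ℂ (GridLeg (GridPoint L (2 * (2 * M)))) := (∑ p' : GridPoint L (2 * (2 * M)), ∑ σ' : Fin 2,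
          ((2 : ℂ) * ((2 : ℂ)⁻¹ * (((U * (β / (2 * (2 * M) : ℕ)) : ℝ) : ℂ) *
              (-∑ k : FreqMomentum L M, ((1 / (β * (L : ℝ) ^ 2) : ℝ) : ℂ) ^ 2 * uvSymbolCT L M β μ 0 klE0 (k, 0))) +
            (2 : ℂ)⁻¹ * (((U * (β / (2 * (2 * M) : ℕ)) : ℝ) : ℂ) ^ 2 *
              ((-∑ k : FreqMomentum L M, ((1 / (β * (L : ℝ) ^ 2) : ℝ) : ℂ) ^ 2 * uvSymbolCT L M β μ 0 klE0 (k, 0)) *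
                ∑ q : GridPoint L (2 * (2 * M)),
                  contr ℂ ((hubbardGridSub L M β (2 * (2 * M))).transpose * hubbardCovAboveCT L M β μ 0 0 klE0 *
                      hubbardGridSub L M β (2 * (2 * M))) (((p', σ'.rev), 0) : GridLeg (GridPoint L (2 * (2 * M)))) ((q, σ'.rev), 1) *
                    contr ℂ ((hubbardGridSub L M β (2 * (2 * M))).transpose * hubbardCovAboveCT L M β μ 0 0 klE0 *
                      hubbardGridSub L M β (2 * (2 * M))) (((q, σ'.rev), 0) : GridLeg (GridPoint L (2 * (2 * M)))) ((p', σ'.rev), 1))) -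
            (2 : ℂ)⁻¹ * ((((U * (β / (2 * (2 * M) : ℕ)) : ℝ) : ℂ) ^ 2 *
                ((-∑ k : FreqMomentum L M, ((1 / (β * (L : ℝ) ^ 2) : ℝ) : ℂ) ^ 2 * uvSymbolCT L M β μ 0 klE0 (k, 0)) *
                 (-∑ k : FreqMomentum L M, ((1 / (β * (L : ℝ) ^ 2) : ℝ) : ℂ) ^ 2 * uvSymbolCT L M β μ 0 klE0 (k, 0)))) *
              (-∑ k : FreqMomentum L M, ((1 / (β * (L : ℝ) ^ 2) : ℝ) : ℂ) ^ 2 * uvSymbolCT L M β μ 0 klE0 (k, 0))))) •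
            (gen ℂ (((p', σ'), 0) : GridLeg (GridPoint L (2 * (2 * M)))) * gen ℂ (((p', σ'), 1) : GridLeg (GridPoint L (2 * (2 * M)))))) with hWD
  set Wa : GrassmannAlgebra ℂ (GridLeg (GridPoint L (2 * (2 * M)))) := W0 - WS - WQ - WD with hWa
  set Xa : HubbardGrassmann L M := ExteriorAlgebra.map (Matrix.toLin' (gridSubMatrix L M β xg τg)) Wa with hXa
  set XS : HubbardGrassmann L M := ExteriorAlgebra.map (Matrix.toLin' (gridSubMatrix L M β xg τg)) WS with hXS
  set XQ : HubbardGrassmann L M := ExteriorAlgebra.map (Matrix.toLin' (gridSubMatrix L M β xg τg)) WQ with hXQ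
  set XD : HubbardGrassmann L M := ExteriorAlgebra.map (Matrix.toLin' (gridSubMatrix L M β xg τg)) WD with hXD
  set fa : TorusSite 2 L → ℝ := fun p => (∑ σ : Fin 2, ((selfEnergy L M β Xa (omega0 M, p) σ).re +
    (selfEnergy L M β Xa ((omega0 M).rev, p) σ).re)) / 4 with hfa
  set fS : TorusSite 2 L → ℝ := fun p => (∑ σ : Fin 2, ((selfEnergy L M β XS (omega0 M, p) σ).re +
    (selfEnergy L M β XS ((omega0 M).rev, p) σ).re)) / 4 with hfS
  set fQ : TorusSite 2 L → ℝ := fun p => (∑ σ : Fin 2, ((selfEnergy L M β XQ (omega0 M, p) σ).re +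
    (selfEnergy L M β XQ ((omega0 M).rev, p) σ).re)) / 4 with hfQ
  set fD : TorusSite 2 L → ℝ := fun p => (∑ σ : Fin 2, ((selfEnergy L M β XD (omega0 M, p) σ).re +
    (selfEnergy L M β XD ((omega0 M).rev, p) σ).re)) / 4 with hfD
  set G : Momentum → ℝ := evalM (symInterp L fa) with hGdef
  set HS : Momentum → ℝ := evalM (symInterp L fS) with hHS
  set HQ : Momentum → ℝ := evalM (symInterp L fQ) with hHQ
  set HD : Momentum → ℝ := evalM (symInterp L fD) with hHD
  set γ : ℝ → Momentum := fun θ : ℝ => (WithLp.toLp 2 (klFermiPoint μ 0 θ) : Momentum) with hγdef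
  -- the split `W₀ = W_a″ + (S + Q_c + D_e)` and the representation of the scale-0 symbol
  have hsplit : W0 = Wa + (WS + WQ + WD) := by rw [hWa]; abel
  have hrep : klLocSelfEnergyRe L M β U μ 0 0 = fa + (fS + fQ + fD) := by
    have hmap : ExteriorAlgebra.map (Matrix.toLin' (gridSubMatrix L M β xg τg)) W0 = Xa + (XS + XQ + XD) := by
      rw [hsplit, map_add, map_add, map_add]
    have hW := klEffectiveAction_zero_frameZero_eq_map_gridSub (L := L) (M := M) hβ0.ne' U μ
    rw [hmap] at hW
    rw [← locSymbol_add β XS XQ, ← locSymbol_add β (XS + XQ) XD, ← locSymbol_add β Xa (XS + XQ + XD)]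
    funext p
    have h := klLocSelfEnergyRe_sub_frame_eq_locRe (L := L) (M := M) hβ0.ne' U μ 0 0 p
    rw [hW, TrigPolyC4v.eval_zero, sub_zero] at h
    exact h
  set F : Momentum → ℝ := evalM (symInterp L (klLocSelfEnergyRe L M β U μ 0 0)) with hF
  have hFGH : F = G + (HS + HQ + HD) := by
    rw [hF, hrep, evalM_symInterp_add_fun, evalM_symInterp_add_fun, evalM_symInterp_add_fun]
  have hνF : klLocalPart L M β U μ 0 0 = F ∘ γ := by
    have h := klLocalPart_zero_sub_frame_eq_comp (L := L) (M := M) β U μ (0 : TrigPolyC4v)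
    have hl : (fun θ => klLocalPart L M β U μ 0 0 θ - (0 : TrigPolyC4v).eval (klFermiPoint μ 0 θ)) = klLocalPart L M β U μ 0 0 := by
      funext θ; simp
    rw [hl] at h
    rw [h]
    congr 1
    funext p
    simp [hF, evalM_apply]
  -- the tail part `W_a″`: value size from its pinned rows
  have hG0 : ∀ q : Momentum, ‖iteratedFDeriv ℝ 0 G q‖ ≤ 2 * (tv * |U| + tb0 * U ^ 2) := by
    intro q
    have hfull : ∀ (σ : Fin 2) (p₀ : GridPoint L (2 * (2 * M))), ∑ p₁ : GridPoint L (2 * (2 * M)),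
        ‖kernel ℂ Wa 2 (fun i => ((![p₀, p₁] i, σ), i))‖ ≤ (tv * |U| + tb0 * U ^ 2) * (β / ((2 * (2 * M) : ℕ) : ℝ)) := by
      intro σ p₀
      have hon := hBon σ p₀
      have hoff := hBoff σ p₀
      simp only [pow_zero] at hoff
      have hsum := add_le_add hon hoff
      rw [← sum_add_distrib] at hsum
      refine le_trans (le_of_eq (sum_congr rfl fun p₁ _ => ?_)) (hsum.trans (le_of_eq (by ring)))
      by_cases hp : p₁.2 - p₀.2 = 0
      · rw [if_pos hp, if_pos hp]; ring
      · rw [if_neg hp, if_neg hp]; ring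
    have h := gridSymbol_norm_le_of_pinned (L := L) (M := M) hβ0.ne' xg τg Wa hfull q
    rw [gridNorm_mul_eq (L := L) (M := M) hβ0] at h
    exact h
  -- on the curve
  have hval : klLocalPart L M β U μ 0 0 θ = G (γ θ) + (HS (γ θ) + HQ (γ θ) + HD (γ θ)) := by
    have h := congrFun hνF θ
    rw [hFGH] at h
    exact h
  have hGabs : |G (γ θ)| ≤ 2 * (tv * |U| + tb0 * U ^ 2) := by
    have h := hG0 (γ θ)
    rwa [norm_iteratedFDeriv_zero, Real.norm_eq_abs] at h
  have hSabs : |HS (γ θ)| ≤ bSA * U ^ 2 := hSv (γ θ)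
  have hQabs : |HQ (γ θ)| ≤ a 0 * U ^ 2 := hQv θ
  have hDval : HD (γ θ) = (∑ σ : Fin 2, ((((1 / (β * (L : ℝ) ^ 2) : ℝ) : ℂ)) * ∑ p : GridPoint L (2 * (2 * M)),
        ((2 : ℂ) * ((2 : ℂ)⁻¹ * (((U * (β / (2 * (2 * M) : ℕ)) : ℝ) : ℂ) *
          (-∑ k : FreqMomentum L M, ((1 / (β * (L : ℝ) ^ 2) : ℝ) : ℂ) ^ 2 * uvSymbolCT L M β μ 0 klE0 (k, 0))) +
        (2 : ℂ)⁻¹ * (((U * (β / (2 * (2 * M) : ℕ)) : ℝ) : ℂ) ^ 2 *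
          ((-∑ k : FreqMomentum L M, ((1 / (β * (L : ℝ) ^ 2) : ℝ) : ℂ) ^ 2 * uvSymbolCT L M β μ 0 klE0 (k, 0)) *
            ∑ q : GridPoint L (2 * (2 * M)),
              contr ℂ ((hubbardGridSub L M β (2 * (2 * M))).transpose * hubbardCovAboveCT L M β μ 0 0 klE0 *
                  hubbardGridSub L M β (2 * (2 * M))) (((p, σ.rev), 0) : GridLeg (GridPoint L (2 * (2 * M)))) ((q, σ.rev), 1) *
                contr ℂ ((hubbardGridSub L M β (2 * (2 * M))).transpose * hubbardCovAboveCT L M β μ 0 0 klE0 *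
                  hubbardGridSub L M β (2 * (2 * M))) (((q, σ.rev), 0) : GridLeg (GridPoint L (2 * (2 * M)))) ((p, σ.rev), 1))) -
        (2 : ℂ)⁻¹ * ((((U * (β / (2 * (2 * M) : ℕ)) : ℝ) : ℂ) ^ 2 *
            ((-∑ k : FreqMomentum L M, ((1 / (β * (L : ℝ) ^ 2) : ℝ) : ℂ) ^ 2 * uvSymbolCT L M β μ 0 klE0 (k, 0)) *
             (-∑ k : FreqMomentum L M, ((1 / (β * (L : ℝ) ^ 2) : ℝ) : ℂ) ^ 2 * uvSymbolCT L M β μ 0 klE0 (k, 0)))) *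
          (-∑ k : FreqMomentum L M, ((1 / (β * (L : ℝ) ^ 2) : ℝ) : ℂ) ^ 2 * uvSymbolCT L M β μ 0 klE0 (k, 0)))))).re) / 2 := congrFun hDc (γ θ)
  rw [hval, hDval]
  have hε0 : 0 ≤ 64 * U ^ 2 * (β / ((2 * (2 * M) : ℕ) : ℝ)) := by positivity
  rw [abs_le] at hGabs hSabs hQabs hce ⊢
  constructor <;> nlinarith [hGabs.1, hGabs.2, hSabs.1, hSabs.2, hQabs.1, hQabs.2, hce.1, hce.2, sq_nonneg U, abs_nonneg U]

/-- **`ν₀ ∈ C⁴` from the free curve alone**: `klLocalPart … 0 0 = F ∘ γ₀` with `F = evalM (symInterp L σ₀)` smooth. [cite: BenfattoGiulianiMastropietro2006, §2.4] -/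
theorem contDiff_four_klLocalPart_frameZero
    (hγ : ContDiff ℝ 4 fun θ : ℝ => (WithLp.toLp 2 (klFermiPoint μ 0 θ) : Momentum)) :
    ContDiff ℝ 4 (fun θ : ℝ => klLocalPart L M β U μ 0 0 θ) := by
  have h := klLocalPart_zero_sub_frame_eq_comp (L := L) (M := M) β U μ (0 : TrigPolyC4v)
  have hl : (fun θ => klLocalPart L M β U μ 0 0 θ - (0 : TrigPolyC4v).eval (klFermiPoint μ 0 θ)) = klLocalPart L M β U μ 0 0 := by
    funext θ; simp
  rw [hl] at h
  rw [show (fun θ : ℝ => klLocalPart L M β U μ 0 0 θ) = klLocalPart L M β U μ 0 0 from rfl, h]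
  exact ((contDiff_evalM _).sub (contDiff_evalM _)).comp hγ

end Owner



/-! ## §2c Regime suppliers for the discharge: the free curve's `C⁴` data and `T₀ ≥ 1/128` -/

section Suppliers

variable {L M : ℕ} [NeZero L] [NeZero M] {μ U β : ℝ}

/-- **The FREE Fermi-point map is `C⁴` with bounded derivatives on the window** (`fermiPointLp_C4_of_frameOK` at the bare frame `K = 0`, which is
admissible for every package: the data of the frame do not enter). [cite: BenfattoGiulianiMastropietro2006, §2.4 Lemma 2.1] -/
theorem freeFermiPointLp_C4 (hμ : μ ∈ klWindowC) :
    ∃ D : ℕ → ℝ, ContDiff ℝ 4 (fun θ : ℝ => (WithLp.toLp 2 (klFermiPoint μ 0 θ) : Momentum)) ∧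
      ∀ θ : ℝ, ∀ i, 1 ≤ i → i ≤ 4 → ‖iteratedDeriv i (fun θ : ℝ => (WithLp.toLp 2 (klFermiPoint μ 0 θ) : Momentum)) θ‖ ≤ D i := by
  set R₀ : RenConsts := ⟨0, 0, fun _ => 0⟩ with hR₀
  have hR : ∀ j, 0 ≤ R₀.Gfr j := fun _ => le_rfl
  have hRW : R₀.WF := ⟨le_rfl, le_rfl, hR⟩
  obtain ⟨c₃, hc₃, U₀, hU₀, h⟩ := fermiPointLp_C4_of_frameOK R₀ hR
  set U₁ : ℝ := min U₀ (Real.sqrt (c₃ / 5)) with hU₁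
  have hs : 0 < Real.sqrt (c₃ / 5) := Real.sqrt_pos.2 (by positivity)
  have hU₁0 : 0 < U₁ := lt_min hU₀ hs
  have hU₁le : U₁ ≤ U₀ := min_le_left _ _
  have hβ : klBetaMin ≤ Real.exp (c₃ / U₁ ^ 2) := by
    have h1 : U₁ ^ 2 ≤ c₃ / 5 := by
      have h2 : U₁ ≤ Real.sqrt (c₃ / 5) := min_le_right _ _
      have h3 : U₁ ^ 2 ≤ Real.sqrt (c₃ / 5) ^ 2 := pow_le_pow_left₀ hU₁0.le h2 2
      rwa [Real.sq_sqrt (by positivity)] at h3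
    have h5 : (5 : ℝ) ≤ c₃ / U₁ ^ 2 := by
      rw [le_div_iff₀ (by positivity)]; linarith
    have he : Real.exp 5 ≥ 128 := by
      have h2 : (2.7 : ℝ) ≤ Real.exp 1 := by have := Real.exp_one_gt_d9; norm_num at this; linarith
      have : Real.exp 5 = Real.exp 1 ^ 5 := by rw [← Real.exp_nat_mul]; norm_num
      rw [this]
      have h3 : (2.7 : ℝ) ^ 5 ≤ Real.exp 1 ^ 5 := pow_le_pow_left₀ (by norm_num) h2 5
      have h4 : (128 : ℝ) ≤ (2.7 : ℝ) ^ 5 := by norm_num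
      linarith
    have : Real.exp 5 ≤ Real.exp (c₃ / U₁ ^ 2) := Real.exp_le_exp.2 h5
    simp only [klBetaMin]; linarith
  obtain ⟨D, -, hD⟩ := h c₃ hc₃ le_rfl U₁ hU₁0 hU₁le (Real.exp (c₃ / U₁ ^ 2)) hβ le_rfl
  obtain ⟨hγ, hd⟩ := hD μ hμ 0 (klFrameOK_zeroC hRW U₁ _ hμ)
  exact ⟨fun i => D ^ i, hγ, fun θ i hi1 hi4 => hd i hi1 hi4 θ⟩

omit [NeZero M] in
/-- **`T₀ ≥ 1/128` on the engine regime** (`…TadpoleRegime` ∘ `…TadpoleBridge`). [cite: BenfattoGiulianiMastropietro2006, §2.1 (2.3)-(2.6)] -/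
theorem scaleZero_tadpole_re_ge_inv_128 (hβ : klBetaMin ≤ β) (hμ : μ ∈ klWindowC) (hL : klEngL₃ β U ≤ L) (hM : klEngM₃ β U L ≤ M) :
    (1 : ℝ) / 128 ≤ (∑ k : FreqMomentum L M, ((1 / (β * (L : ℝ) ^ 2) : ℝ) : ℂ) ^ 2 * uvSymbolCT L M β μ 0 klE0 (k, 0)).re := by
  have hβ0 : 0 < β := lt_of_lt_of_le (by norm_num [klBetaMin]) hβ
  have hL0 : (0 : ℝ) < (L : ℝ) ^ 2 := by have := NeZero.ne L; positivity
  have h := scaleZero_tadpole_re_ge_of_le (L := L) (M := M) hβ0 μ 0 (uvTadpoleSum_ge_sq_div_128 (L := L) (M := M) (U := U) hβ hμ hL hM)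
  have he : (L : ℝ) ^ 2 / 128 / (L : ℝ) ^ 2 = 1 / 128 := by
    rw [div_div, mul_comm, ← div_div, div_self hL0.ne']
  rwa [he] at h

end Suppliers

end Summit.HubbardSuperconductivity.HubbardSuperconductivity.Theorems.KLRegimeSplit

end
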